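import Literature.Analysis.FunctionSpaces.TorusLinearisedNSForcedH1Balance
import Literature.Analysis.FunctionSpaces.TorusClassicalNSVStabilityFlux
import Literature.Analysis.ODE.LinearComparison
import HarnessLib

/-!
# `V`-growth of the inhomogeneous linearised Navier–Stokes flow on `T³` with integrable
# coefficients

Function-space support file (all results proved; no definitions, no named facts), the LINEAR twin of
`TorusClassicalNSVStability.lean` (`V`-stability of two strong solutions with the integrable
coefficient `‖Δu₂(s)‖₂²`) for the inhomogeneous linearised equation of
`TorusLinearisedNSForcedEnergy.lean` / `TorusLinearisedNSForcedH1Balance.lean`,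

`∂ₜw + (u·∇)w + (w·∇)u = νΔw − ∇q + g`, `div w = 0`,

along a jointly smooth divergence-free base field `u` on `[a, a + τ] × T^d`, `card d = 3`, whose
slices have zero mean, enstrophy `‖∇u(t)‖₂² ≤ M₁` and `∫ₐ^{a+τ} ‖Δu(s)‖₂² ds ≤ Y` — the a priori
class `L^∞(V) ∩ L²(D(A))` of strong solutions; NO sup norm of `u` or of `∇u` enters (contrast the
sup-norm coefficient bounds of `Torus.linearisedNSForced_integral_norm_sq_le`,
`Torus.linearisedNSForced_gradNormSq_flux_le`):

* `Torus.exists_linearisedNSForced_h1_flux_le` — the pointwise-in-time differential inequality: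
  there is `K = K(d) ≥ 0` such that for `ν > 0`, smooth `U, W, G : T^d → ℝ^d` with `∫ U = ∫ W = 0`
  and `‖∇U‖₂² ≤ M₁`, the sum `E' + V'` of the right-hand sides of the energy and enstrophy
  identities of the forced linearised equation (`E = ∫ ‖W‖²`, `V = ‖∇W‖₂²`) is at most
  `(K(√M₁ + ν⁻⁷M₁⁴ + ν⁻¹(M₁ + ‖ΔU‖₂²)) + 1)(E + V) + (1 + ν⁻¹) ∫ ‖G‖²`
  (the three flux bounds of `TorusClassicalNSVStabilityFlux` with `ε = ν/4`, Young for the two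
  source pairings, the `‖ΔW‖₂²`-terms being absorbed by the dissipation `2ν‖ΔW‖₂²`);
* `Torus.linearisedNSForced_h1_le_mul_of_integral_laplacian_sq_le` — **`V`-growth**: for `ν > 0`,
  `M₁, Y` and `τ > 0` there is `C = C(d, ν, M₁, Y, τ)` such that every smooth divergence-free
  zero-mean solution `(w, q)` with a jointly smooth source `g` obeys
  `∫ ‖w(t)‖² + ‖∇w(t)‖₂² ≤ C (∫ ‖w(a)‖² + ‖∇w(a)‖₂² + ∫ₐᵗ ∫ ‖g‖²)` for all `t ∈ [a, a + τ]` —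
  Grönwall with the continuous integrable coefficient `β(s) = α + γ‖Δu(s)‖₂²` and the source
  `A(s) = (1 + ν⁻¹) ∫ ‖g(s)‖²` (`Literature.Analysis.ODE.le_linearComparison`),
  `C = (1 + ν⁻¹) exp(ατ + γY)`.

These are the estimates of the linearised flow in `V` along `u ∈ L^∞(0,T;V) ∩ L²(0,T;D(A))` of
Constantin–Foias 1988, Ch. 14, (14.2)–(14.4) (the first variation equation and its energy
estimates "by the same a priori bounds as for `u`"), in the quantitative form consumed by the
first- and second-order remainder estimates of the solution map at `V`-data base points.

## Mathlib / tree search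

Tree (reused): the two balances `Torus.linearisedNSForced_hasDerivWithinAt_integral_norm_sq`,
`Torus.linearisedNSForced_hasDerivWithinAt_gradNormSq`; the flux toolkit
`Torus.abs_integral_inner_convect_self_le_gradNormSq`,
`Torus.abs_integral_inner_convect_laplacian_transport_le`,
`Torus.abs_integral_inner_convect_laplacian_stretching_le` (`TorusClassicalNSVStabilityFlux`);
Young `Literature.Analysis.FluidPDE.Torus.neg_mul_integral_norm_sq_add_integral_inner_le`;
`Literature.Analysis.ODE.le_linearComparison`; `Torus.IsSmoothSpaceTimeOn.continuousOn_integral`.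
The pattern is `Torus.IsClassicalNSSolutionOn.h1_sub_le_mul_of_integral_laplacian_sq_le`
(`TorusClassicalNSVStability`, two solutions, no source). Searched `linearisedNSForced_h1`,
`VGrowth`, `integral_laplacian_sq_le` under `FunctionSpaces/Torus*`, `FluidPDE/Torus*`: only the
sup-norm-coefficient Grönwall bounds of the linearised equation. Mathlib:
`intervalIntegral.continuousOn_primitive_interval'`, `intervalIntegral.integral_mono_on`,
`intervalIntegral.integral_mono_interval`.

## References

* P. Constantin, C. Foias, *Navier–Stokes Equations*, Univ. Chicago Press 1988, Ch. 14,
  (14.2)–(14.4) and Lemma 14.3; Ch. 10, Thm. 10.2, (10.7). [ConstantinFoiasNSE1988]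
* R. Temam, *Infinite-Dimensional Dynamical Systems in Mechanics and Physics*, 2nd ed., Springer
  1997, Ch. III §6.2 (6.16)–(6.17), Ch. VI §3.1. [Temam1997]
-/

open MeasureTheory Set Filter
open scoped InnerProductSpace ContDiff Topology

noncomputable section

namespace Literature.Analysis.FunctionSpaces

namespace Torus

variable {d : Type*} [Fintype d] [DecidableEq d]

/-! ## The pointwise differential inequality -/

/-- **The differential inequality of the forced linearised flow in `V`.** On `T^d` with
`card d = 3` there is `K ≥ 0` such that for every `ν > 0`, every `M₁` and all smooth
`U, W, G : T^d → ℝ^d` with `∫ U = 0`, `∫ W = 0` and `‖∇U‖₂² ≤ M₁`, writing `E = ∫ ‖W‖²`,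
`V = ‖∇W‖₂²`, the sum of the right-hand sides of the energy and enstrophy identities of
`∂ₜW + (U·∇)W + (W·∇)U = νΔW − ∇q + G`,
`(−2νV − 2∫⟪(W·∇)U, W⟫ + 2∫⟪G, W⟫) + (−2ν‖ΔW‖₂² + 2∫⟪(U·∇)W + (W·∇)U, ΔW⟫ − 2∫⟪G, ΔW⟫)`, is at most
`(K (√M₁ + ν⁻⁷M₁⁴ + ν⁻¹(M₁ + ‖ΔU‖₂²)) + 1) (E + V) + (1 + ν⁻¹) ∫ ‖G‖²`: the energy flux is
`≤ 2C‖∇U‖₂ V` (`abs_integral_inner_convect_self_le_gradNormSq`), the two Laplacian pairings are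
absorbed by the dissipation (`abs_integral_inner_convect_laplacian_transport_le`,
`abs_integral_inner_convect_laplacian_stretching_le` with `ε = ν/4`), and the source pairings obey
`2∫⟪G, W⟫ ≤ E + ∫‖G‖²`, `−2∫⟪G, ΔW⟫ ≤ ν‖ΔW‖₂² + ν⁻¹∫‖G‖²` (Young) — the energy estimates of the
first variation equation along `u ∈ L^∞(V) ∩ L²(D(A))`, Constantin–Foias (14.2)–(14.4), one level
up in `V`. [cite: ConstantinFoiasNSE1988, Ch. 14 (14.2)–(14.4)] -/
theorem exists_linearisedNSForced_h1_flux_le (hd : Fintype.card d = 3) :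
    ∃ K : ℝ, 0 ≤ K ∧ ∀ {ν M₁ : ℝ} {U W G : UnitAddTorus d → EuclideanSpace ℝ d}, 0 < ν →
      IsSmooth U → IsSmooth W → IsSmooth G → HasZeroMean U → HasZeroMean W →
      gradNormSq U ≤ M₁ →
      (-(2 * ν * gradNormSq W) - 2 * (∫ x, ⟪convect W U x, W x⟫_ℝ) +
          2 * ∫ x, ⟪G x, W x⟫_ℝ) +
        (-(2 * ν * ∫ x, ‖laplacian W x‖ ^ 2) +
          2 * (∫ x, ⟪convect U W x + convect W U x, laplacian W x⟫_ℝ) -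
          2 * ∫ x, ⟪G x, laplacian W x⟫_ℝ) ≤
      (K * (Real.sqrt M₁ + (ν ^ 7)⁻¹ * M₁ ^ 4 + ν⁻¹ * (M₁ + ∫ x, ‖laplacian U x‖ ^ 2)) + 1) *
          ((∫ x, ‖W x‖ ^ 2) + gradNormSq W) +
        (1 + ν⁻¹) * ∫ x, ‖G x‖ ^ 2 := by
  obtain ⟨C₁, hC₁0, hC₁⟩ := abs_integral_inner_convect_self_le_gradNormSq (d := d) hd
  obtain ⟨K_b, hKb0, hKb⟩ := abs_integral_inner_convect_laplacian_transport_le (d := d) hd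
  obtain ⟨K_c, hKc0, hKc⟩ := abs_integral_inner_convect_laplacian_stretching_le (d := d) hd
  refine ⟨2 * C₁ + 32768 * K_b + 8 * K_c, by positivity, ?_⟩
  intro ν M₁ U W G hν hU hW hG hU0 hW0 hGU
  -- (d) the two source pairings (Young), before abbreviating
  have hs₁ : 2 * ∫ x, ⟪G x, W x⟫_ℝ ≤ (∫ x, ‖W x‖ ^ 2) + ∫ x, ‖G x‖ ^ 2 := by
    have h := Literature.Analysis.FluidPDE.Torus.neg_mul_integral_norm_sq_add_integral_inner_le
      (ν := 1 / 2) (by norm_num) hG hW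
    have h4 : (4 * (1 / 2 : ℝ))⁻¹ = 1 / 2 := by norm_num
    rw [h4] at h
    linarith
  have hs₂ : -(2 * ∫ x, ⟪G x, laplacian W x⟫_ℝ) ≤
      ν * (∫ x, ‖laplacian W x‖ ^ 2) + ν⁻¹ * ∫ x, ‖G x‖ ^ 2 := by
    have h := Literature.Analysis.FluidPDE.Torus.neg_mul_integral_norm_sq_add_integral_inner_le
      (half_pos hν) hG hW.laplacian.neg
    simp only [Pi.neg_apply, norm_neg, inner_neg_right, integral_neg] at h
    have h4 : (4 * (ν / 2))⁻¹ = 2⁻¹ * ν⁻¹ := by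
      rw [mul_inv]; field_simp; norm_num
    rw [h4] at h
    linarith
  set E : ℝ := ∫ x, ‖W x‖ ^ 2 with hE
  set V : ℝ := gradNormSq W with hV
  set L : ℝ := ∫ x, ‖laplacian W x‖ ^ 2 with hL
  set L_U : ℝ := ∫ x, ‖laplacian U x‖ ^ 2 with hLU
  set S : ℝ := ∫ x, ‖G x‖ ^ 2 with hS
  set K : ℝ := 2 * C₁ + 32768 * K_b + 8 * K_c with hK
  have hE0 : 0 ≤ E := integral_nonneg fun x => sq_nonneg _
  have hV0 : 0 ≤ V := gradNormSq_nonneg _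
  have hL0 : 0 ≤ L := integral_nonneg fun x => sq_nonneg _
  have hLU0 : 0 ≤ L_U := integral_nonneg fun x => sq_nonneg _
  have hS0 : 0 ≤ S := integral_nonneg fun x => sq_nonneg _
  have hGU0 : 0 ≤ gradNormSq U := gradNormSq_nonneg _
  have hM₁ : 0 ≤ M₁ := hGU0.trans hGU
  have hν4 : 0 < ν / 4 := by positivity
  have hν0 : ν ≠ 0 := hν.ne'
  -- (a) the energy flux
  have ha : |∫ x, ⟪convect W U x, W x⟫_ℝ| ≤ C₁ * V * Real.sqrt M₁ :=
    (hC₁ W U hW hU hW0).trans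
      (mul_le_mul_of_nonneg_left (Real.sqrt_le_sqrt hGU) (mul_nonneg hC₁0 hV0))
  -- (b) the transport term against the Laplacian
  have hb : |∫ x, ⟪convect U W x, laplacian W x⟫_ℝ| ≤
      ν / 4 * L + K_b * ((ν / 4) ^ 7)⁻¹ * M₁ ^ 4 * V := by
    refine (hKb (ν / 4) hν4 U W hU hW hU0).trans (add_le_add le_rfl ?_)
    exact mul_le_mul_of_nonneg_right
      (mul_le_mul_of_nonneg_left (pow_le_pow_left₀ hGU0 hGU 4) (by positivity)) hV0
  -- (c) the stretching term against the Laplacian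
  have hc : |∫ x, ⟪convect W U x, laplacian W x⟫_ℝ| ≤
      ν / 4 * L + K_c * (ν / 4)⁻¹ * (M₁ + L_U) * V := by
    refine (hKc (ν / 4) hν4 W U hW hU hW0).trans (add_le_add le_rfl ?_)
    exact mul_le_mul_of_nonneg_right
      (mul_le_mul_of_nonneg_left (add_le_add hGU le_rfl) (by positivity)) hV0
  have e7 : ((ν / 4) ^ 7)⁻¹ = 16384 * (ν ^ 7)⁻¹ := by
    rw [div_pow, inv_div, div_eq_mul_inv]
    norm_num
  have e1 : (ν / 4)⁻¹ = 4 * ν⁻¹ := by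
    rw [inv_div, div_eq_mul_inv]
  rw [e7] at hb
  rw [e1] at hc
  -- splitting the enstrophy pairing
  have hsplit : ∫ x, ⟪convect U W x + convect W U x, laplacian W x⟫_ℝ =
      (∫ x, ⟪convect U W x, laplacian W x⟫_ℝ) + ∫ x, ⟪convect W U x, laplacian W x⟫_ℝ := by
    have i1 : Integrable (fun x => ⟪convect U W x, laplacian W x⟫_ℝ) volume :=
      ((hU.convect hW).inner hW.laplacian).integrable
    have i2 : Integrable (fun x => ⟪convect W U x, laplacian W x⟫_ℝ) volume :=
      ((hW.convect hU).inner hW.laplacian).integrable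
    rw [← integral_add i1 i2]
    exact integral_congr_ae (ae_of_all _ fun x => inner_add_left _ _ _)
  rw [hsplit]
  -- bookkeeping
  have q0 := neg_abs_le (∫ x, ⟪convect W U x, W x⟫_ℝ)
  have q0b := le_abs_self (∫ x, ⟪convect U W x, laplacian W x⟫_ℝ)
  have q0c := le_abs_self (∫ x, ⟪convect W U x, laplacian W x⟫_ℝ)
  have hK1 : 2 * C₁ ≤ K := by rw [hK]; linarith
  have hK2 : 32768 * K_b ≤ K := by rw [hK]; linarith
  have hK3 : 8 * K_c ≤ K := by rw [hK]; linarith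
  have hf1 : 0 ≤ Real.sqrt M₁ * V := mul_nonneg (Real.sqrt_nonneg _) hV0
  have hf2 : 0 ≤ (ν ^ 7)⁻¹ * M₁ ^ 4 * V := by positivity
  have hf3 : 0 ≤ ν⁻¹ * (M₁ + L_U) * V := by positivity
  have q1 : 2 * C₁ * (Real.sqrt M₁ * V) ≤ K * (Real.sqrt M₁ * V) :=
    mul_le_mul_of_nonneg_right hK1 hf1
  have q2 : 32768 * K_b * ((ν ^ 7)⁻¹ * M₁ ^ 4 * V) ≤ K * ((ν ^ 7)⁻¹ * M₁ ^ 4 * V) :=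
    mul_le_mul_of_nonneg_right hK2 hf2
  have q3 : 8 * K_c * (ν⁻¹ * (M₁ + L_U) * V) ≤ K * (ν⁻¹ * (M₁ + L_U) * V) :=
    mul_le_mul_of_nonneg_right hK3 hf3
  have q4 : 0 ≤ K * (Real.sqrt M₁ + (ν ^ 7)⁻¹ * M₁ ^ 4 + ν⁻¹ * (M₁ + L_U)) * E :=
    mul_nonneg (mul_nonneg (by positivity) (by positivity)) hE0
  have q5 : 0 ≤ ν * V := mul_nonneg hν.le hV0
  linarith [ha, hb, hc, q0, q0b, q0c, q1, q2, q3, q4, q5, hs₁, hs₂, hV0]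

/-! ## `V`-growth of the forced linearised flow -/

section Growth

variable {ν : ℝ}

/-- **`V`-growth of the inhomogeneous linearised Navier–Stokes flow on `T³` with integrable
coefficients.** On `T^d` with `card d = 3`, for `ν > 0` and numbers `M₁, Y` and `τ > 0` there is
`C = C(d, ν, M₁, Y, τ)` such that: for every jointly smooth base field `u` on `[a, a + τ] × T^d`
with divergence-free zero-mean slices, `‖∇u(t)‖₂² ≤ M₁` on the interval and
`∫ₐ^{a+τ} ‖Δu(s)‖₂² ds ≤ Y`, every jointly smooth `(w, q, g)` with `div w(t) = 0`, `∫ w(t) = 0` and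
`∂ₜw + (u·∇)w + (w·∇)u = νΔw − ∇q + g` pointwise on `[a, a + τ] × T^d` (one-sided time derivative)
obeys `∫ ‖w(t)‖² + ‖∇w(t)‖₂² ≤ C (∫ ‖w(a)‖² + ‖∇w(a)‖₂² + ∫ₐᵗ ∫ ‖g(s)‖² ds)` for every
`t ∈ [a, a + τ]`. Proof: `Φ = E + V` has `Φ' ≤ A + βΦ` within `[a, a + τ]` with the continuous
coefficient `β(s) = K(√M₁ + ν⁻⁷M₁⁴ + ν⁻¹M₁) + 1 + Kν⁻¹‖Δu(s)‖₂²` and source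
`A(s) = (1 + ν⁻¹)∫‖g(s)‖²` (`exists_linearisedNSForced_h1_flux_le` and the two balances of the
forced linearised equation), so `Φ(t) ≤ exp(∫ₐᵗ β)(Φ(a) + ∫ₐᵗ A) ≤ (1 + ν⁻¹) exp(ατ + Kν⁻¹Y)
(Φ(a) + ∫ₐᵗ∫‖g‖²)` (`Literature.Analysis.ODE.le_linearComparison`) — the a priori estimate of the
linearised flow in `V` along `u ∈ L^∞(0,T;V) ∩ L²(0,T;D(A))`, Constantin–Foias, Ch. 14.
[cite: ConstantinFoiasNSE1988, Ch. 14 (14.2)–(14.4)] -/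
theorem linearisedNSForced_h1_le_mul_of_integral_laplacian_sq_le
    (hd : Fintype.card d = 3) (hν : 0 < ν) (M₁ Y τ : ℝ) (hτ : 0 < τ) :
    ∃ C : ℝ, ∀ {a : ℝ} {u w g : ℝ → UnitAddTorus d → EuclideanSpace ℝ d}
      {q : ℝ → UnitAddTorus d → ℝ},
      IsSmoothSpaceTimeOn (Icc a (a + τ)) u → (∀ t ∈ Icc a (a + τ), IsDivFree (u t)) →
      (∀ t ∈ Icc a (a + τ), HasZeroMean (u t)) →
      (∀ t ∈ Icc a (a + τ), gradNormSq (u t) ≤ M₁) →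
      (∫ s in a..(a + τ), (∫ x, ‖laplacian (u s) x‖ ^ 2) ≤ Y) →
      IsSmoothSpaceTimeOn (Icc a (a + τ)) w → IsSmoothSpaceTimeOn (Icc a (a + τ)) q →
      IsSmoothSpaceTimeOn (Icc a (a + τ)) g →
      (∀ t ∈ Icc a (a + τ), IsDivFree (w t)) → (∀ t ∈ Icc a (a + τ), HasZeroMean (w t)) →
      (∀ t ∈ Icc a (a + τ), ∀ x, timeDerivWithin (Icc a (a + τ)) w t x + convect (u t) (w t) x +
        convect (w t) (u t) x = ν • laplacian (w t) x - gradient (q t) x + g t x) →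
      ∀ t ∈ Icc a (a + τ), (∫ x, ‖w t x‖ ^ 2) + gradNormSq (w t) ≤
        C * ((∫ x, ‖w a x‖ ^ 2) + gradNormSq (w a) + ∫ s in a..t, ∫ x, ‖g s x‖ ^ 2) := by
  obtain ⟨K, hK0, hK⟩ := exists_linearisedNSForced_h1_flux_le (d := d) hd
  set α : ℝ := K * (Real.sqrt M₁ + (ν ^ 7)⁻¹ * M₁ ^ 4 + ν⁻¹ * M₁) + 1 with hα
  set γ : ℝ := K * ν⁻¹ with hγ
  set c : ℝ := 1 + ν⁻¹ with hc
  refine ⟨Real.exp (α * τ + γ * Y) * c, ?_⟩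
  intro a u w g q hu hudiv hz hG hY hw hq hg hwdiv hwz hlin t ht
  set b : ℝ := a + τ with hb
  have hab : a < b := by rw [hb]; linarith
  have ha : a ∈ Icc a b := left_mem_Icc.2 hab.le
  have hU : UniqueDiffOn ℝ (Icc a b) := uniqueDiffOn_Icc hab
  have hM₁ : 0 ≤ M₁ := (gradNormSq_nonneg _).trans (hG a ha)
  have hνi : 0 ≤ ν⁻¹ := inv_nonneg.2 hν.le
  have hα0 : 0 ≤ α := by positivity
  have hγ0 : 0 ≤ γ := by positivity
  have hc1 : 1 ≤ c := le_add_of_nonneg_right hνi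
  have hc0 : 0 ≤ c := zero_le_one.trans hc1
  have hg' : ∀ s ∈ Icc a b, IsSmooth (g s) := fun s hs => hg.isSmooth_slice hs
  -- the `H¹` energy and its derivative
  set Φ : ℝ → ℝ := fun s => (∫ x, ‖w s x‖ ^ 2) + gradNormSq (w s) with hΦ
  set Φ' : ℝ → ℝ := fun s =>
    (-(2 * ν * gradNormSq (w s)) - 2 * (∫ x, ⟪convect (w s) (u s) x, w s x⟫_ℝ) +
        2 * ∫ x, ⟪g s x, w s x⟫_ℝ) +
      (-(2 * ν * ∫ x, ‖laplacian (w s) x‖ ^ 2) +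
        2 * (∫ x, ⟪convect (u s) (w s) x + convect (w s) (u s) x, laplacian (w s) x⟫_ℝ) -
        2 * ∫ x, ⟪g s x, laplacian (w s) x⟫_ℝ) with hΦ'
  have hΦd : ∀ s ∈ Icc a b, HasDerivWithinAt Φ (Φ' s) (Icc a b) s := fun s hs =>
    (linearisedNSForced_hasDerivWithinAt_integral_norm_sq hu hudiv hw hq hwdiv hg' hlin hab hs).add
      (linearisedNSForced_hasDerivWithinAt_gradNormSq hu hw hq hwdiv hg' hlin hab hs)
  have hΦ0 : ∀ s, 0 ≤ Φ s := fun s =>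
    add_nonneg (integral_nonneg fun x => sq_nonneg _) (gradNormSq_nonneg _)
  -- the continuous integrable coefficient and the continuous source
  set L₂ : ℝ → ℝ := fun s => ∫ x, ‖laplacian (u s) x‖ ^ 2 with hL₂
  set β : ℝ → ℝ := fun s => α + γ * L₂ s with hβ
  set S : ℝ → ℝ := fun s => ∫ x, ‖g s x‖ ^ 2 with hS
  set A : ℝ → ℝ := fun s => c * S s with hA
  have hφ : IsSmoothSpaceTimeOn (Icc a b) (fun s x => ‖laplacian (u s) x‖ ^ 2) :=
    (hu.laplacian hU).norm_sq ℝ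
  have hL₂c : ContinuousOn L₂ (Icc a b) := hφ.continuousOn_integral (convex_Icc a b)
  have hL₂0 : ∀ s, 0 ≤ L₂ s := fun s => integral_nonneg fun x => sq_nonneg _
  have hβc : ContinuousOn β (Icc a b) := continuousOn_const.add (continuousOn_const.mul hL₂c)
  have hβ0 : ∀ s, 0 ≤ β s := fun s => add_nonneg hα0 (mul_nonneg hγ0 (hL₂0 s))
  have hψ : IsSmoothSpaceTimeOn (Icc a b) (fun s x => ‖g s x‖ ^ 2) := hg.norm_sq ℝ
  have hSc : ContinuousOn S (Icc a b) := hψ.continuousOn_integral (convex_Icc a b)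
  have hS0 : ∀ s, 0 ≤ S s := fun s => integral_nonneg fun x => sq_nonneg _
  have hAc : ContinuousOn A (Icc a b) := continuousOn_const.mul hSc
  have hA0 : ∀ s, 0 ≤ A s := fun s => mul_nonneg hc0 (hS0 s)
  -- the differential inequality `Φ' ≤ A + β Φ`
  have hbound : ∀ s ∈ Icc a b, Φ' s ≤ A s + β s * Φ s := by
    intro s hs
    have h := hK hν (hu.isSmooth_slice hs) (hw.isSmooth_slice hs) (hg' s hs) (hz s hs) (hwz s hs)
      (hG s hs)
    have e : K * (Real.sqrt M₁ + (ν ^ 7)⁻¹ * M₁ ^ 4 +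
        ν⁻¹ * (M₁ + ∫ x, ‖laplacian (u s) x‖ ^ 2)) + 1 = β s := by
      simp only [hβ, hα, hγ, hL₂]
      ring
    have h' : Φ' s ≤ β s * Φ s + A s := by
      simp only [hΦ', hΦ, hA, hS, hc]
      rw [← e]
      exact h
    linarith
  -- Grönwall with the variable coefficient and the source
  have hΦc : ContinuousOn Φ (Icc a b) := fun s hs => (hΦd s hs).continuousWithinAt
  have hΦr : ∀ s ∈ Ico a b, HasDerivWithinAt Φ (Φ' s) (Ici s) s := fun s hs =>
    ((hΦd s (Ico_subset_Icc_self hs)).mono (Icc_subset_Icc hs.1 le_rfl)).mono_of_mem_nhdsWithin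
      (Icc_mem_nhdsGE hs.2)
  have hcmp := Literature.Analysis.ODE.le_linearComparison hΦc hΦr hAc hβc
    (fun s hs => hbound s (Ico_subset_Icc_self hs)) ht
  -- the exponent: `∫ₐᵗ β ≤ ατ + γY`
  have hL₂i : IntervalIntegrable L₂ volume a t :=
    (hL₂c.mono (Icc_subset_Icc_right ht.2)).intervalIntegrable_of_Icc ht.1
  have hL₂i' : IntervalIntegrable L₂ volume a b := hL₂c.intervalIntegrable_of_Icc hab.le
  have hint : ∫ s in a..t, β s = α * (t - a) + γ * ∫ s in a..t, L₂ s := by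
    simp only [hβ]
    rw [intervalIntegral.integral_add intervalIntegrable_const (hL₂i.const_mul γ),
      intervalIntegral.integral_const, intervalIntegral.integral_const_mul, smul_eq_mul]
    ring
  have hmono : ∫ s in a..t, L₂ s ≤ Y := by
    calc ∫ s in a..t, L₂ s ≤ ∫ s in a..b, L₂ s :=
          intervalIntegral.integral_mono_interval le_rfl ht.1 ht.2
            (Eventually.of_forall fun s => hL₂0 s) hL₂i'
      _ ≤ Y := hY
  have hexp : ∫ s in a..t, β s ≤ α * τ + γ * Y := by
    rw [hint]
    have h1 : α * (t - a) ≤ α * τ := by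
      refine mul_le_mul_of_nonneg_left ?_ hα0
      rw [hb] at ht
      linarith [ht.2]
    have h2 : γ * ∫ s in a..t, L₂ s ≤ γ * Y := mul_le_mul_of_nonneg_left hmono hγ0
    linarith
  -- the source integral: the weight `exp (-∫ₐˢ β) ≤ 1` is dropped
  have hβi : IntervalIntegrable β volume a t :=
    (hβc.mono (Icc_subset_Icc_right ht.2)).intervalIntegrable_of_Icc ht.1
  have hBc : ContinuousOn (fun s => ∫ r in a..s, β r) (Icc a t) := by
    have h := intervalIntegral.continuousOn_primitive_interval' hβi left_mem_uIcc
    rwa [uIcc_of_le ht.1] at h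
  have hAt : ContinuousOn A (Icc a t) := hAc.mono (Icc_subset_Icc_right ht.2)
  have hAi : IntervalIntegrable A volume a t := hAt.intervalIntegrable_of_Icc ht.1
  have hAwi : IntervalIntegrable (fun s => A s * Real.exp (-(∫ r in a..s, β r))) volume a t :=
    (hAt.mul hBc.neg.rexp).intervalIntegrable_of_Icc ht.1
  have hsrc : ∫ s in a..t, A s * Real.exp (-(∫ r in a..s, β r)) ≤ ∫ s in a..t, A s := by
    refine intervalIntegral.integral_mono_on ht.1 hAwi hAi fun s hs => ?_
    have hB0 : 0 ≤ ∫ r in a..s, β r := intervalIntegral.integral_nonneg hs.1 fun r _ => hβ0 r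
    have he : Real.exp (-(∫ r in a..s, β r)) ≤ 1 := Real.exp_le_one_iff.2 (by linarith)
    calc A s * Real.exp (-(∫ r in a..s, β r)) ≤ A s * 1 := mul_le_mul_of_nonneg_left he (hA0 s)
      _ = A s := mul_one _
  have hAint : ∫ s in a..t, A s = c * ∫ s in a..t, S s := by
    simp only [hA]
    exact intervalIntegral.integral_const_mul c S
  have hI0 : 0 ≤ ∫ s in a..t, S s := intervalIntegral.integral_nonneg ht.1 fun s _ => hS0 s
  -- assembling
  have hME : Real.exp (∫ s in a..t, β s) ≤ Real.exp (α * τ + γ * Y) := Real.exp_le_exp.2 hexp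
  have he0 : 0 ≤ Real.exp (∫ s in a..t, β s) := (Real.exp_pos _).le
  have h1 : ∫ s in a..t, A s * Real.exp (-(∫ r in a..s, β r)) ≤ c * ∫ s in a..t, S s :=
    hsrc.trans_eq hAint
  have h2 : Φ a + c * ∫ s in a..t, S s ≤ c * (Φ a + ∫ s in a..t, S s) := by
    nlinarith [hΦ0 a, hc1]
  calc Φ t ≤ Real.exp (∫ s in a..t, β s) *
        (Φ a + ∫ s in a..t, A s * Real.exp (-(∫ r in a..s, β r))) := hcmp
    _ ≤ Real.exp (∫ s in a..t, β s) * (Φ a + c * ∫ s in a..t, S s) :=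
        mul_le_mul_of_nonneg_left (add_le_add le_rfl h1) he0
    _ ≤ Real.exp (α * τ + γ * Y) * (Φ a + c * ∫ s in a..t, S s) :=
        mul_le_mul_of_nonneg_right hME (add_nonneg (hΦ0 a) (mul_nonneg hc0 hI0))
    _ ≤ Real.exp (α * τ + γ * Y) * (c * (Φ a + ∫ s in a..t, S s)) :=
        mul_le_mul_of_nonneg_left h2 (Real.exp_pos _).le
    _ = Real.exp (α * τ + γ * Y) * c * (Φ a + ∫ s in a..t, S s) := by ring

end Growth

end Torus

end Literature.Analysis.FunctionSpaces

end
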